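import Mathlib.Analysis.SpecialFunctions.ImproperIntegrals
import Mathlib.MeasureTheory.Integral.Pi
import Literature.NumberTheory.Transcendental.KZCalculus
import Literature.NumberTheory.Transcendental.SemialgebraicMapsProofs
import Literature.ModelTheory.ExponentialFields.TarskiSeidenbergProofs
import HarnessLib

/-!
# The KZ calculus: "algebraic integrands reduce to rational ones" (proof file)

Sibling proof file of `Literature/NumberTheory/Transcendental/KZCalculus.lean` for the named fact
`Literature.NumberTheory.Transcendental.KZ.exists_isRational_equivalent`: *every integral representation `(σ, f)` (a `ℚ`-semialgebraic
function `f` absolutely integrable on a `ℚ`-semialgebraic `σ ⊆ ℝⁿ`) is equivalent, by the moves of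
the Kontsevich–Zagier calculus, to one whose integrand is a quotient of `ℚ`-polynomials,* and (last
section) for the named fact `Literature.NumberTheory.Transcendental.KZ.exists_integralRep_sub`: *every formal `ℤ`-combination of
integral representations is, modulo the moves, a difference of two representations.*

Source. Kontsevich–Zagier, *Periods* (2001), §1.1, the remark after the Definition (IHÉS preprint
p. 3): "algebraic functions occurring in the integrand can be replaced by rational functions by
introducing more variables. Indeed, using the fact that the integral of any real-valued function
is equal to the area under its graph one can write an arbitrary period as the volume of a domain
defined by polynomial inequalities with rational coefficients, so we never need to integrate any
function more complicated than the constant function 1." No further proof is printed.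

## The proof fixed here

Given `r = (σ, f)` in dimension `n`, let `P(x) = ∏ᵢ (1 + xᵢ²)` (a `ℚ`-polynomial, `P ≥ 1`,
`∫_{ℝⁿ} P⁻¹ < ∞`) and put `a = f·P − 1/(2P)`, `b = f·P + 1/(2P)` on `σ`, so that `b − a = 1/P > 0`
and `b²/2 − a²/2 = f`. The *volume-under-the-graph representation* `r.graphRep` has dimension
`n + 1`, domain the band `B = {(x, t) | x ∈ σ, a x ≤ t ≤ b x}` and integrand `(x, t) ↦ t`
(the polynomial `X_last`, so it has KZ's literal rational shape). With the primitive
`F(x, t) = t²/2` the printed rule (3) (Newton–Leibniz along the last coordinate, the move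
`Literature.NumberTheory.Transcendental.KZ.newtonLeibnizRel`) reads `∫_B t = ∫_σ (b²/2 − a²/2) = ∫_σ f`, i.e. `[graphRep r] − [r]`
is a single move, whence `Equivalent r (graphRep r)`. (KZ's "area under the graph" is the case
`a = 0, b = f`, integrand `1`, which needs `f ≥ 0` and `σ` of finite measure; the weight `P` and the
integrand `t` remove both restrictions while staying inside the printed rules.) Absolute
integrability of `t` on `B` is Tonelli: `∫_B |t| ≤ ∫_σ (|f|·P + 1/(2P))·(1/P) = ∫_σ |f| + ∫ 1/(2P²)`.

## What is and is not proved

Semialgebraicity of `a`, `b` (sum and product of semialgebraic functions) and of the band `B`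
(a region between two semialgebraic graphs), and Borel measurability of `f` on `σ` (used in
Tonelli), are consequences of the **Tarski–Seidenberg projection theorem** (the named fact
`Literature.ModelTheory.ExponentialFields.tarski_seidenberg_real`, BCR 1998, Thm. 2.2.1; not in Mathlib). They are supplied by
`SemialgebraicMapsProofs.lean` modulo that fact. Accordingly this file first proves

* `Literature.KZ.exists_isRational_equivalent_of_tarskiSeidenberg :
    tarski_seidenberg_real (k := ℚ) → exists_isRational_equivalent`,

reducing the fact to Tarski–Seidenberg alone, and then discharges it unconditionally,

* `Literature.KZ.exists_isRational_equivalent_holds : exists_isRational_equivalent`,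

using the proof of the projection theorem `Literature.ModelTheory.ExponentialFields.tarski_seidenberg_real_holds`
(`Literature/ModelTheory/ExponentialFields/TarskiSeidenbergProofs.lean`, Cohen–Hörmander
elimination). Without projection no set of positive measure depending on `f` (such as the region
under its graph) is provably in the Boolean algebra generated by polynomial sign conditions, given
only that the graph of `f` is; so some form of Tarski–Seidenberg is genuinely needed for any proof
along KZ's lines.

## Main definitions and statements

* `Literature.NumberTheory.Transcendental.KZ.graphWeight` — `P(x) = ∏ᵢ (1 + xᵢ²)`; `integrable_graphWeight_inv`.
* `Literature.KZ.IntegralRep.graphLower/graphUpper/graphBand/graphRep` — the construction.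
* `Literature.NumberTheory.Transcendental.KZ.IntegralRep.integrableOn_last_graphBand` — integrability of the lifted integrand.
* `Literature.NumberTheory.Transcendental.KZ.IntegralRep.of_graphRep_sub_of_mem_newtonLeibnizRel` — it is one Newton–Leibniz move.
* `Literature.NumberTheory.Transcendental.KZ.exists_isRational_equivalent_of_tarskiSeidenberg` — the reduction.
* `Literature.NumberTheory.Transcendental.KZ.isRealPeriod_iff_exists_integralRep_of_tarskiSeidenberg` — the companion fact
  `isRealPeriod_iff_exists_integralRep` ("rational ⇔ algebraic integrands") modulo the same input.
* `Literature.NumberTheory.Transcendental.KZ.exists_isRational_equivalent_holds`, `Literature.NumberTheory.Transcendental.KZ.isRealPeriod_iff_exists_integralRep_holds` —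
  the unconditional discharges of the two named facts.
* `Literature.NumberTheory.Transcendental.KZ.IntegralRep.empty`, `IntegralRep.slab`, `IntegralRep.glue`,
  `IntegralRep.exists_of_add_of_sub_of_mem_relations`, `Literature.NumberTheory.Transcendental.KZ.exists_integralRep_sub_holds` — the
  discharge of `exists_integralRep_sub` (see the section "Every formal combination is a difference
  of two representations" below for the proof fixed there).

## References

* M. Kontsevich, D. Zagier, *Periods*, in: Mathematics Unlimited — 2001 and Beyond, Springer
  (2001), 771–808, §1.1 (remark after the Definition), §1.2 (rules (1)–(3)).
* J. Bochnak, M. Coste, M.-F. Roy, *Real Algebraic Geometry*, Springer (1998), Thm. 2.2.1.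
* J. Viu-Sos, *Periods of Kontsevich–Zagier I: a semi-canonical reduction*, arXiv:1509.01097,
  §2 (a compact-domain refinement of the same reduction, also via semialgebraic geometry).
-/

noncomputable section

open MeasureTheory MvPolynomial Set

namespace Literature.NumberTheory.Transcendental

namespace KZ

variable {n : ℕ}

/-! ### The weight -/

/-- The weight `P(x) = ∏ᵢ (1 + xᵢ²) ≥ 1`, a `ℚ`-polynomial with `∫_{ℝⁿ} 1/P < ∞`; it normalises the
thickness of the band in `IntegralRep.graphBand` so that the lifted integrand stays integrable over
domains of infinite measure. [KZ 2001, §1.1] [cite: KontsevichZagier2001, §1.1] -/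
def graphWeight (x : Fin n → ℝ) : ℝ := ∏ i, (1 + x i ^ 2)

/-- `graphWeight` is the value of the polynomial `∏ᵢ (1 + Xᵢ²)`. [KZ 2001, §1.1] [cite: KontsevichZagier2001, §1.1] -/
lemma aeval_prod_one_add_X_sq (x : Fin n → ℝ) :
    aeval x (∏ i, (1 + X i ^ 2) : MvPolynomial (Fin n) ℚ) = graphWeight x := by
  simp [graphWeight, map_prod]

/-- `1 ≤ P(x)`. [KZ 2001, §1.1] [cite: KontsevichZagier2001, §1.1] -/
lemma one_le_graphWeight (x : Fin n → ℝ) : 1 ≤ graphWeight x :=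
  Finset.one_le_prod fun i _ => by nlinarith [sq_nonneg (x i)]

/-- `0 < P(x)`. [KZ 2001, §1.1] [cite: KontsevichZagier2001, §1.1] -/
lemma graphWeight_pos (x : Fin n → ℝ) : 0 < graphWeight x :=
  one_pos.trans_le (one_le_graphWeight x)

/-- `P` is continuous. [KZ 2001, §1.1] [cite: KontsevichZagier2001, §1.1] -/
lemma continuous_graphWeight : Continuous (graphWeight : (Fin n → ℝ) → ℝ) := by
  unfold graphWeight
  exact continuous_finsetProd _ fun i _ => by fun_prop

/-- `P` is a `ℚ`-semialgebraic function on every `ℚ`-semialgebraic set. [KZ 2001, §1.1] [cite: KontsevichZagier2001, §1.1] -/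
lemma isSemialgebraicFunOn_graphWeight {s : Set (Fin n → ℝ)} (hs : Literature.ModelTheory.ExponentialFields.IsSemialgebraic ℚ s) :
    IsSemialgebraicFunOn ℚ s graphWeight :=
  (isSemialgebraicFunOn_aeval hs _).congr fun x _ => aeval_prod_one_add_X_sq x

/-- `1 / (2P)` is a `ℚ`-semialgebraic function on every `ℚ`-semialgebraic set. [KZ 2001, §1.1] [cite: KontsevichZagier2001, §1.1] -/
lemma isSemialgebraicFunOn_graphWeight_inv_half {s : Set (Fin n → ℝ)} (hs : Literature.ModelTheory.ExponentialFields.IsSemialgebraic ℚ s) :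
    IsSemialgebraicFunOn ℚ s (fun x => (graphWeight x)⁻¹ / 2) := by
  refine (isSemialgebraicFunOn_aeval_div_aeval hs 1 (2 * ∏ i, (1 + X i ^ 2)) fun x _ => ?_).congr
    fun x _ => ?_
  · rw [map_mul, aeval_prod_one_add_X_sq]
    simpa using (graphWeight_pos x).ne'
  · dsimp only
    rw [map_mul, aeval_prod_one_add_X_sq]
    simp [div_eq_inv_mul, mul_comm]

/-- `∫_{ℝⁿ} 1/P < ∞`: a product of the integrable factors `1/(1 + xᵢ²)`
(`integrable_inv_one_add_sq`, `Integrable.fintype_prod`). [KZ 2001, §1.1] [cite: KontsevichZagier2001, §1.1] -/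
lemma integrable_graphWeight_inv : Integrable (fun x : Fin n → ℝ => (graphWeight x)⁻¹) := by
  have := Integrable.fintype_prod (ι := Fin n) (f := fun _ (t : ℝ) => (1 + t ^ 2)⁻¹)
    (μ := fun _ => volume) (fun _ => integrable_inv_one_add_sq)
  simpa [graphWeight, Finset.prod_inv_distrib, volume_pi] using this

/-- `∫_{ℝⁿ} 1/(2P²) < ∞` (as `P⁻² ≤ P⁻¹`). [KZ 2001, §1.1] [cite: KontsevichZagier2001, §1.1] -/
lemma integrable_graphWeight_inv_sq_half :
    Integrable (fun x : Fin n → ℝ => (graphWeight x)⁻¹ ^ 2 / 2) := by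
  refine (integrable_graphWeight_inv.div_const 2).mono' ?_
    (Filter.Eventually.of_forall fun x => ?_)
  · have : Continuous fun x : Fin n → ℝ => (graphWeight x)⁻¹ ^ 2 / 2 :=
      ((continuous_graphWeight.inv₀ fun x => (graphWeight_pos x).ne').pow 2).div_const 2
    exact this.aestronglyMeasurable
  · have h0 : 0 ≤ (graphWeight x)⁻¹ := inv_nonneg.mpr (graphWeight_pos x).le
    have h1 : (graphWeight x)⁻¹ ≤ 1 := inv_le_one_of_one_le₀ (one_le_graphWeight x)
    rw [Real.norm_of_nonneg (by positivity)]
    nlinarith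

/-! ### The volume-under-the-graph representation -/

namespace IntegralRep

variable (r : IntegralRep n)

/-- Lower edge `a = f·P − 1/(2P)` of the band over the domain of `r = (σ, f)`. [KZ 2001, §1.1] [cite: KontsevichZagier2001, §1.1] -/
def graphLower (x : Fin n → ℝ) : ℝ := r.integrand x * graphWeight x - (graphWeight x)⁻¹ / 2

/-- Upper edge `b = f·P + 1/(2P)` of the band over the domain of `r = (σ, f)`. [KZ 2001, §1.1] [cite: KontsevichZagier2001, §1.1] -/
def graphUpper (x : Fin n → ℝ) : ℝ := r.integrand x * graphWeight x + (graphWeight x)⁻¹ / 2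

/-- `b − a = 1/P`. [KZ 2001, §1.1] [cite: KontsevichZagier2001, §1.1] -/
lemma graphUpper_sub_graphLower (x : Fin n → ℝ) :
    r.graphUpper x - r.graphLower x = (graphWeight x)⁻¹ := by
  simp only [graphUpper, graphLower]
  ring

/-- `a ≤ b`. [KZ 2001, §1.1] [cite: KontsevichZagier2001, §1.1] -/
lemma graphLower_le_graphUpper (x : Fin n → ℝ) : r.graphLower x ≤ r.graphUpper x :=
  sub_nonneg.mp (by rw [graphUpper_sub_graphLower]; exact inv_nonneg.mpr (graphWeight_pos x).le)

/-- `b²/2 − a²/2 = f`: the Newton–Leibniz boundary term of the primitive `t²/2` is the original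
integrand. [KZ 2001, §1.1] [cite: KontsevichZagier2001, §1.1] -/
lemma sq_graphUpper_sub_sq_graphLower (x : Fin n → ℝ) :
    r.graphUpper x ^ 2 / 2 - r.graphLower x ^ 2 / 2 = r.integrand x := by
  have h := (graphWeight_pos x).ne'
  simp only [graphUpper, graphLower]
  field_simp
  ring

/-- On the fibre `[a x, b x]` one has `|t| ≤ |f x|·P x + 1/(2 P x)`. [KZ 2001, §1.1] [cite: KontsevichZagier2001, §1.1] -/
lemma abs_le_of_mem_Icc_graphLower_graphUpper (x : Fin n → ℝ) {t : ℝ}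
    (ht : t ∈ Icc (r.graphLower x) (r.graphUpper x)) :
    |t| ≤ |r.integrand x| * graphWeight x + (graphWeight x)⁻¹ / 2 := by
  have hw := graphWeight_pos x
  have h1 : -|r.integrand x| ≤ r.integrand x := neg_abs_le _
  have h2 : r.integrand x ≤ |r.integrand x| := le_abs_self _
  simp only [graphLower, graphUpper, mem_Icc] at ht
  rw [abs_le]
  constructor <;> nlinarith

/-- The band `B = {(x, t) | x ∈ σ, a x ≤ t ≤ b x} ⊆ ℝⁿ⁺¹` over the domain, in the format of the
Newton–Leibniz move `Literature.NumberTheory.Transcendental.KZ.newtonLeibnizRel`. [KZ 2001, §1.1] [cite: KontsevichZagier2001, §1.1] -/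
def graphBand : Set (Fin (n + 1) → ℝ) :=
  {z | Fin.init z ∈ r.domain ∧ r.graphLower (Fin.init z) ≤ z (Fin.last n) ∧
    z (Fin.last n) ≤ r.graphUpper (Fin.init z)}

/-- Fibrewise membership in the band. [KZ 2001, §1.1] [cite: KontsevichZagier2001, §1.1] -/
lemma snoc_mem_graphBand {x : Fin n → ℝ} {t : ℝ} :
    Fin.snoc x t ∈ r.graphBand ↔ x ∈ r.domain ∧ t ∈ Icc (r.graphLower x) (r.graphUpper x) := by
  simp [graphBand]

variable (hTS : Literature.ModelTheory.ExponentialFields.tarski_seidenberg_real (k := ℚ))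
include hTS

/-- `a` is `ℚ`-semialgebraic on `σ` (Tarski–Seidenberg: product and difference of semialgebraic
functions). [KZ 2001, §1.1; BCR 1998, Prop. 2.2.6] [cite: KontsevichZagier2001, §1.1] -/
lemma isSemialgebraicFunOn_graphLower : IsSemialgebraicFunOn ℚ r.domain r.graphLower :=
  (r.isSemialgebraicFunOn_integrand.mul_of_tarskiSeidenberg hTS
    (isSemialgebraicFunOn_graphWeight r.isSemialgebraic_domain)).sub_of_tarskiSeidenberg hTS
    (isSemialgebraicFunOn_graphWeight_inv_half r.isSemialgebraic_domain)

/-- `b` is `ℚ`-semialgebraic on `σ` (Tarski–Seidenberg). [KZ 2001, §1.1; BCR 1998, Prop. 2.2.6] [cite: KontsevichZagier2001, §1.1] -/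
lemma isSemialgebraicFunOn_graphUpper : IsSemialgebraicFunOn ℚ r.domain r.graphUpper :=
  (r.isSemialgebraicFunOn_integrand.mul_of_tarskiSeidenberg hTS
    (isSemialgebraicFunOn_graphWeight r.isSemialgebraic_domain)).add_of_tarskiSeidenberg hTS
    (isSemialgebraicFunOn_graphWeight_inv_half r.isSemialgebraic_domain)

/-- The band is `ℚ`-semialgebraic: it is the intersection of the epigraph of `a` and the
hypograph of `b` (Tarski–Seidenberg). [KZ 2001, §1.1; BCR 1998, Thm. 2.2.1] [cite: KontsevichZagier2001, §1.1] -/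
lemma isSemialgebraic_graphBand : Literature.ModelTheory.ExponentialFields.IsSemialgebraic ℚ r.graphBand := by
  convert ((r.isSemialgebraicFunOn_graphLower hTS).isSemialgebraic_setOf_ge hTS).inter
    ((r.isSemialgebraicFunOn_graphUpper hTS).isSemialgebraic_setOf_le hTS) using 1
  ext z
  simp only [graphBand, mem_setOf_eq, mem_inter_iff]
  tauto

/-- The band is Lebesgue measurable. [KZ 2001, §1.1] [cite: KontsevichZagier2001, §1.1] -/
lemma measurableSet_graphBand : MeasurableSet r.graphBand :=
  Literature.ModelTheory.ExponentialFields.IsSemialgebraic.measurableSet_holds (r.isSemialgebraic_graphBand hTS)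

/-- **Integrability of the lifted integrand**: `(x, t) ↦ t` is absolutely integrable on the band.
Bound `|t| ≤ |f x|·P x + 1/(2P x)` on the fibre over `x` (length `1/P x`); identify `ℝⁿ⁺¹` with
`ℝ × ℝⁿ` by the volume-preserving `MeasurableEquiv.piFinSuccAbove _ (Fin.last n)`, apply Tonelli
(`MeasureTheory.lintegral_prod_symm`; measurability of `f` on `σ` is
`IsSemialgebraicFunOn.measurable_indicator_of_tarskiSeidenberg`) and get
`∫_B |t| ≤ ∫_σ |f| + ∫_{ℝⁿ} 1/(2P²) < ∞`. [KZ 2001, §1.1] [cite: KontsevichZagier2001, §1.1] -/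
lemma integrableOn_last_graphBand :
    IntegrableOn (fun z : Fin (n + 1) → ℝ => z (Fin.last n)) r.graphBand volume := by
  have hσm : MeasurableSet r.domain := IntegralRep.measurableSet_domain_holds r
  have hBm : MeasurableSet r.graphBand := r.measurableSet_graphBand hTS
  -- a measurable majorant on the base
  set f₀ : (Fin n → ℝ) → ℝ := r.domain.indicator r.integrand with hf₀
  have hf₀m : Measurable f₀ :=
    r.isSemialgebraicFunOn_integrand.measurable_indicator_of_tarskiSeidenberg hTS hσm
  set M : (Fin n → ℝ) → ℝ := fun x => |f₀ x| * graphWeight x + (graphWeight x)⁻¹ / 2 with hM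
  have hwm : Measurable (graphWeight : (Fin n → ℝ) → ℝ) := continuous_graphWeight.measurable
  have hMm : Measurable M :=
    ((continuous_abs.measurable.comp hf₀m).mul hwm).add (hwm.inv.div_const 2)
  have hM0 : ∀ x, 0 ≤ M x := fun x => by
    have := graphWeight_pos x
    positivity
  have hinit : Measurable (Fin.init : (Fin (n + 1) → ℝ) → Fin n → ℝ) :=
    measurable_pi_lambda _ fun i => measurable_pi_apply _
  set H : (Fin (n + 1) → ℝ) → ℝ := r.graphBand.indicator fun z => M (Fin.init z) with hH
  have hHm : Measurable H := (hMm.comp hinit).indicator hBm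
  rw [← integrable_indicator_iff hBm]
  refine Integrable.mono' (g := H) ?_ ((measurable_pi_apply _).indicator hBm).aestronglyMeasurable
    (Filter.Eventually.of_forall fun z => ?_)
  swap
  · -- the pointwise bound `‖B.indicator (·.last) z‖ ≤ H z`
    by_cases hz : z ∈ r.graphBand
    · simp only [indicator_of_mem hz, hH, Real.norm_eq_abs]
      have hx : Fin.init z ∈ r.domain := hz.1
      have hf : f₀ (Fin.init z) = r.integrand (Fin.init z) := indicator_of_mem hx _
      rw [hM]
      dsimp only
      rw [hf]
      exact r.abs_le_of_mem_Icc_graphLower_graphUpper (Fin.init z) ⟨hz.2.1, hz.2.2⟩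
    · simp [hH, indicator_of_notMem hz]
  · -- integrability of the majorant `H`, by Tonelli along the last coordinate
    refine ⟨hHm.aestronglyMeasurable, ?_⟩
    set e : (Fin (n + 1) → ℝ) ≃ᵐ ℝ × (Fin n → ℝ) :=
      MeasurableEquiv.piFinSuccAbove (fun _ => ℝ) (Fin.last n) with he_def
    have he : MeasurePreserving e volume volume :=
      volume_preserving_piFinSuccAbove (fun _ => ℝ) (Fin.last n)
    have he_symm : ∀ p : ℝ × (Fin n → ℝ), e.symm p = Fin.snoc p.2 p.1 := fun p => by
      simp [he_def, MeasurableEquiv.piFinSuccAbove, Fin.snocEquiv]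
    -- the fibres of `‖H‖ₑ`
    have hfib : ∀ (x : Fin n → ℝ) (t : ℝ), ‖H (Fin.snoc x t)‖ₑ =
        (Icc (r.graphLower x) (r.graphUpper x)).indicator
          (fun _ => r.domain.indicator (fun x => ENNReal.ofReal (M x)) x) t := by
      intro x t
      by_cases hx : x ∈ r.domain
      · by_cases ht : t ∈ Icc (r.graphLower x) (r.graphUpper x)
        · rw [indicator_of_mem ht, indicator_of_mem hx, hH,
            indicator_of_mem ((r.snoc_mem_graphBand).2 ⟨hx, ht⟩), Fin.init_snoc,
            Real.enorm_eq_ofReal (hM0 x)]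
        · rw [indicator_of_notMem ht, hH,
            indicator_of_notMem (fun h => ht ((r.snoc_mem_graphBand).1 h).2), enorm_zero]
      · rw [hH, indicator_of_notMem (fun h => hx ((r.snoc_mem_graphBand).1 h).1), enorm_zero,
          indicator_of_notMem hx]
        simp
    have hmeas : AEMeasurable (fun p : ℝ × (Fin n → ℝ) => ‖H (e.symm p)‖ₑ)
        ((volume : Measure ℝ).prod (volume : Measure (Fin n → ℝ))) :=
      ((hHm.comp e.symm.measurable).enorm).aemeasurable
    have hg2 := integrable_graphWeight_inv_sq_half (n := n)
    unfold HasFiniteIntegral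
    calc ∫⁻ z, ‖H z‖ₑ
        = ∫⁻ p, ‖H (e.symm p)‖ₑ :=
          ((he.symm e).lintegral_comp_emb e.symm.measurableEmbedding _).symm
      _ = ∫⁻ p, ‖H (e.symm p)‖ₑ ∂((volume : Measure ℝ).prod (volume : Measure (Fin n → ℝ))) := by
          rw [Measure.volume_eq_prod]
      _ = ∫⁻ x, ∫⁻ t, ‖H (e.symm (t, x))‖ₑ := lintegral_prod_symm _ hmeas
      _ = ∫⁻ x, r.domain.indicator (fun x => ENNReal.ofReal (M x)) x *
            volume (Icc (r.graphLower x) (r.graphUpper x)) := by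
          congr 1 with x
          simp_rw [he_symm, hfib x]
          exact lintegral_indicator_const measurableSet_Icc _
      _ = ∫⁻ x, r.domain.indicator (fun x => ENNReal.ofReal |r.integrand x| +
            ENNReal.ofReal ((graphWeight x)⁻¹ ^ 2 / 2)) x := by
          congr 1 with x
          rw [Real.volume_Icc, graphUpper_sub_graphLower]
          by_cases hx : x ∈ r.domain
          · rw [indicator_of_mem hx, indicator_of_mem hx, ← ENNReal.ofReal_mul (hM0 x),
              ← ENNReal.ofReal_add (abs_nonneg _) (by positivity)]
            congr 1
            rw [hM]
            dsimp only
            rw [hf₀, indicator_of_mem hx]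
            have := (graphWeight_pos x).ne'
            field_simp
          · simp [indicator_of_notMem hx]
      _ ≤ ∫⁻ x, r.domain.indicator (fun x => ‖r.integrand x‖ₑ) x +
            ENNReal.ofReal ((graphWeight x)⁻¹ ^ 2 / 2) := by
          refine lintegral_mono fun x => ?_
          by_cases hx : x ∈ r.domain
          · rw [indicator_of_mem hx, indicator_of_mem hx, Real.enorm_eq_ofReal_abs]
          · simp [indicator_of_notMem hx]
      _ = (∫⁻ x in r.domain, ‖r.integrand x‖ₑ) +
            ∫⁻ x : Fin n → ℝ, ‖(graphWeight x)⁻¹ ^ 2 / 2‖ₑ := by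
          rw [lintegral_add_right _ (by fun_prop), lintegral_indicator hσm]
          congr 1
          refine lintegral_congr fun x => ?_
          rw [Real.enorm_eq_ofReal (by positivity)]
      _ < ⊤ := ENNReal.add_lt_top.2 ⟨r.integrableOn.2, hg2.2⟩

/-- **The volume-under-the-graph representation** of `r = (σ, f)`: dimension `n + 1`, domain the
band `{(x, t) | x ∈ σ, f x·P x − 1/(2P x) ≤ t ≤ f x·P x + 1/(2P x)}`, integrand `(x, t) ↦ t`
(KZ: "the integral of any real-valued function is equal to the area under its graph"; the weight
`P` and the integrand `t` in place of `1` handle unbounded domains and the sign of `f`).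
[KZ 2001, §1.1, remark after the Definition] [cite: KontsevichZagier2001, §1.1 remark after the Definition] -/
def graphRep : IntegralRep (n + 1) where
  domain := r.graphBand
  integrand z := z (Fin.last n)
  isSemialgebraic_domain := r.isSemialgebraic_graphBand hTS
  isSemialgebraicFunOn_integrand :=
    (isSemialgebraicFunOn_aeval (r.isSemialgebraic_graphBand hTS) (X (Fin.last n))).congr
      fun z _ => by simp
  integrableOn := r.integrableOn_last_graphBand hTS

/-- The domain of `graphRep r` is the band. [KZ 2001, §1.1] [cite: KontsevichZagier2001, §1.1] -/
@[simp] lemma domain_graphRep : (r.graphRep hTS).domain = r.graphBand := rfl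

/-- The integrand of `graphRep r` is the last coordinate. [KZ 2001, §1.1] [cite: KontsevichZagier2001, §1.1] -/
@[simp] lemma integrand_graphRep : (r.graphRep hTS).integrand = fun z => z (Fin.last n) := rfl

/-- `graphRep r` has KZ's literal (rational, indeed polynomial) shape: integrand `X_last / 1`.
[KZ 2001, §1.1] [cite: KontsevichZagier2001, §1.1] -/
theorem isRational_graphRep : (r.graphRep hTS).IsRational :=
  ⟨X (Fin.last n), 1, fun _ _ => by simp, fun z _ => by simp [graphRep]⟩

/-- `[graphRep r] − [r]` is a single Newton–Leibniz move (printed rule (3)) with base `r`, band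
edges `a = graphLower r`, `b = graphUpper r` and primitive `F (x, t) = t² / 2`:
`∂F/∂t = t` is the lifted integrand and `F (x, b x) − F (x, a x) = f x`.
[KZ 2001, §1.1 remark; §1.2, rule (3)] [cite: KontsevichZagier2001, §1.2 rule (3)] -/
theorem of_graphRep_sub_of_mem_newtonLeibnizRel :
    of (r.graphRep hTS) - of r ∈ newtonLeibnizRel := by
  refine ⟨n, r.graphRep hTS, r, r.graphLower, r.graphUpper, fun z => z (Fin.last n) ^ 2 / 2, ?_,
    r.isSemialgebraicFunOn_graphLower hTS, r.isSemialgebraicFunOn_graphUpper hTS,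
    fun x _ => r.graphLower_le_graphUpper x, rfl, ?_, ?_, ?_, rfl⟩
  · -- `F = (1/2) X_last²` is a polynomial, hence semialgebraic on the band
    refine (isSemialgebraicFunOn_aeval (r.isSemialgebraic_graphBand hTS)
      (C (1 / 2 : ℚ) * X (Fin.last n) ^ 2)).congr fun z _ => ?_
    simp [div_eq_inv_mul]
  · -- continuity of `t ↦ t²/2` on the closed fibre
    intro x _
    simp only [Fin.snoc_last]
    exact ((continuous_pow 2).div_const 2).continuousOn.congr fun t _ => rfl
  · -- `d/dt (t²/2) = t` on the open fibre
    intro x _ t _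
    have h1 : (fun s : ℝ => (Fin.snoc x s : Fin (n + 1) → ℝ) (Fin.last n) ^ 2 / 2) =
        fun s => s ^ 2 / 2 := by
      funext s
      simp
    show HasDerivAt (fun s : ℝ => (Fin.snoc x s : Fin (n + 1) → ℝ) (Fin.last n) ^ 2 / 2)
      ((Fin.snoc x t : Fin (n + 1) → ℝ) (Fin.last n)) t
    rw [h1, Fin.snoc_last]
    exact ((hasDerivAt_pow 2 t).div_const 2).congr_deriv (by norm_num)
  · -- the boundary term is the original integrand
    intro x _
    simp only [Fin.snoc_last]
    exact (r.sq_graphUpper_sub_sq_graphLower x).symm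

/-- `r` is equivalent, by the moves of the KZ calculus, to its volume-under-the-graph
representation. [KZ 2001, §1.1 remark; §1.2] [cite: KontsevichZagier2001, §1.1 remark after the Definition] -/
theorem equivalent_graphRep : Equivalent r (r.graphRep hTS) :=
  Equivalent.symm (newtonLeibnizRel_subset_relations
    (r.of_graphRep_sub_of_mem_newtonLeibnizRel hTS))

end IntegralRep

/-- **`exists_isRational_equivalent` modulo Tarski–Seidenberg.** Every integral representation is
equivalent, by one Newton–Leibniz move, to its volume-under-the-graph representation
`IntegralRep.graphRep`, which has KZ's literal rational shape. The only input beyond Mathlib is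
the projection theorem `Literature.ModelTheory.ExponentialFields.tarski_seidenberg_real` (needed to see that the band under the graph of
a semialgebraic function is `ℚ`-semialgebraic).
[KZ 2001, §1.1, remark after the Definition; §1.2] [cite: KontsevichZagier2001, §1.1 remark after the Definition] -/
theorem exists_isRational_equivalent_of_tarskiSeidenberg (hTS : Literature.ModelTheory.ExponentialFields.tarski_seidenberg_real (k := ℚ)) :
    exists_isRational_equivalent (n := n) := fun r =>
  ⟨n + 1, r.graphRep hTS, r.isRational_graphRep hTS, r.equivalent_graphRep hTS⟩

/-- **`isRealPeriod_iff_exists_integralRep` modulo Tarski–Seidenberg** ("rational ⇔ algebraic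
integrands"): real periods are exactly the values of integral representations with
`ℚ`-semialgebraic integrands. (`→`: a rational representation is a representation;
`←`: pass to the equivalent rational representation `graphRep r`, which has the same value by
soundness of the moves, `Equivalent.value_eq_holds`.)
[KZ 2001, §1.1, remark after the Definition] [cite: KontsevichZagier2001, §1.1 remark after the Definition] -/
theorem isRealPeriod_iff_exists_integralRep_of_tarskiSeidenberg
    (hTS : Literature.ModelTheory.ExponentialFields.tarski_seidenberg_real (k := ℚ)) : isRealPeriod_iff_exists_integralRep := by
  intro x
  constructor
  · intro hx
    obtain ⟨n, r, -, hr⟩ := isRealPeriod_iff_exists_isRational_holds.mp hx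
    exact ⟨n, r, hr⟩
  · rintro ⟨n, r, rfl⟩
    exact isRealPeriod_iff_exists_isRational_holds.mpr
      ⟨n + 1, r.graphRep hTS, r.isRational_graphRep hTS,
        (Equivalent.value_eq_holds (r.equivalent_graphRep hTS)).symm⟩

/-- **Discharge of the named fact `Literature.NumberTheory.Transcendental.KZ.exists_isRational_equivalent`** ("algebraic integrands
reduce to rational ones by introducing more variables"): every integral representation is
equivalent, by the moves of the KZ calculus, to one of KZ's literal rational shape — the reduction
`exists_isRational_equivalent_of_tarskiSeidenberg` fed with the proof
`Literature.ModelTheory.ExponentialFields.tarski_seidenberg_real_holds` of the Tarski–Seidenberg projection theorem over `ℝ`.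
[KZ 2001, §1.1, remark after the Definition; §1.2]
[cite: KontsevichZagier2001, §1.1 remark after the Definition] -/
theorem exists_isRational_equivalent_holds : exists_isRational_equivalent (n := n) :=
  exists_isRational_equivalent_of_tarskiSeidenberg Literature.ModelTheory.ExponentialFields.tarski_seidenberg_real_holds

/-- **Discharge of the named fact `Literature.NumberTheory.Transcendental.KZ.isRealPeriod_iff_exists_integralRep`** ("rational ⇔
algebraic integrands"): real periods are exactly the values of integral representations with
`ℚ`-semialgebraic integrands. [KZ 2001, §1.1, remark after the Definition]
[cite: KontsevichZagier2001, §1.1 remark after the Definition] -/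
theorem isRealPeriod_iff_exists_integralRep_holds : isRealPeriod_iff_exists_integralRep :=
  isRealPeriod_iff_exists_integralRep_of_tarskiSeidenberg Literature.ModelTheory.ExponentialFields.tarski_seidenberg_real_holds

end KZ

end Literature.NumberTheory.Transcendental

/-! ### Every formal combination is a difference of two representations
(D-0014 discharge of `Literature.NumberTheory.Transcendental.KZ.exists_integralRep_sub`)

Kontsevich–Zagier [KZ 2001, §1.2, Conjecture 1] phrase the period conjecture for *two* integral
representations of one number (one can pass from one to the other using only rules (1)–(3); so
restated in Viu-Sos, arXiv:1509.01097, §1.1 and Cresson–Viu-Sos, arXiv:1912.01751, p. 2); on the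
formal group `Literature.NumberTheory.Transcendental.KZ.FormalRep` the natural statement is about the kernel of `eval`. The named fact
`exists_integralRep_sub` is the bookkeeping identifying the two: every `c : FormalRep` is
`≡ [r] − [r']` modulo `relations`. No proof is printed; the one fixed here uses only the moves:

* the *empty representation* `IntegralRep.empty n` (domain `∅`) satisfies `[∅] ∈ relations`, by
  domain additivity for `∅ = ∅ ∪ ∅`; hence `0 ≡ [∅] − [∅]`, `[r] ≡ [r] − [∅]`, `−[r] ≡ [∅] − [r]`;
* the *slab* `IntegralRep.slab r j` (dimension `n + 1`, domain `σ × [j, j + 1]`, integrand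
  `(x, t) ↦ f x`) differs from `r` by one Newton–Leibniz move with primitive `F (x, t) = t · f x`
  and constant edges `j ≤ j + 1`; iterating, `r` is equivalent to a representation in every
  dimension `N ≥ n` (`IntegralRep.exists_equivalent_of_le`);
* two representations of the same dimension with disjoint domains *glue* (`IntegralRep.glue`,
  integrand `𝟙_{σ₁} f₁ + 𝟙_{σ₂} f₂`) by one domain-additivity move; so for `r₁`, `r₂` of any
  dimensions, raising both to dimension `max n m` and then to the disjoint slabs at levels `[0, 1]`
  and `[2, 3]` gives one `R` with `[r₁] + [r₂] − [R] ∈ relations`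
  (`IntegralRep.exists_of_add_of_sub_of_mem_relations`), which handles sums in the induction over
  the free abelian group.

Semialgebraicity inputs: cylinders and polynomial inequalities (no Tarski–Seidenberg), gluing of
semialgebraic functions along two pieces (`Literature.NumberTheory.Transcendental.IsSemialgebraicFunOn.union`, no Tarski–Seidenberg),
and the product `t · f x` (`IsSemialgebraicFunOn.mul_holds`, Tarski–Seidenberg, proved in the tree).
Integrability on the slab is `Integrable.comp_snd` after the volume-preserving identification
`ℝⁿ⁺¹ ≃ ℝ × ℝⁿ`. -/

namespace Literature.NumberTheory.Transcendental

section Union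

variable {k : Type*} {R : Type*} [CommRing k] [CommRing R] [LT R] [Algebra k R] {m : ℕ}

/-- **Gluing semialgebraic functions.** If `F` agrees with a `k`-semialgebraic function `f` on `s`
and with a `k`-semialgebraic function `g` on `t`, then `F` is `k`-semialgebraic on `s ∪ t`: its
graph over `s ∪ t` is the union of the graphs of `f` over `s` and of `g` over `t` (immediate from
the definition; no Tarski–Seidenberg needed).
[Bochnak–Coste–Roy 1998, Def. 2.2.5] [cite: BochnakCosteRoy1998, Def. 2.2.5] -/
theorem IsSemialgebraicFunOn.union {s t : Set (Fin m → R)} {f g F : (Fin m → R) → R}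
    (hf : IsSemialgebraicFunOn k s f) (hg : IsSemialgebraicFunOn k t g) (hfs : EqOn F f s)
    (hgt : EqOn F g t) : IsSemialgebraicFunOn k (s ∪ t) F := by
  rw [isSemialgebraicFunOn_iff] at hf hg ⊢
  convert hf.union hg using 1
  ext z
  simp only [mem_setOf_eq, mem_union]
  constructor
  · rintro ⟨hz | hz, h⟩
    · exact Or.inl ⟨hz, h.trans (hfs hz)⟩
    · exact Or.inr ⟨hz, h.trans (hgt hz)⟩
  · rintro (⟨hz, h⟩ | ⟨hz, h⟩)
    · exact ⟨Or.inl hz, h.trans (hfs hz).symm⟩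
    · exact ⟨Or.inr hz, h.trans (hgt hz).symm⟩

/-- Constant functions with value a natural number are `k`-semialgebraic on every
`k`-semialgebraic set (the polynomial `j ∈ k[X]`). [BCR 1998, §2.2] [cite: BochnakCosteRoy1998, §2.2] -/
theorem isSemialgebraicFunOn_natCast {s : Set (Fin m → R)} (hs : Literature.ModelTheory.ExponentialFields.IsSemialgebraic k s) (j : ℕ) :
    IsSemialgebraicFunOn k s (fun _ => (j : R)) :=
  (isSemialgebraicFunOn_aeval hs (j : MvPolynomial (Fin m) k)).congr fun x _ => by simp

end Union

namespace KZ

variable {n m : ℕ}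

namespace IntegralRep

/-! #### The empty representation -/

/-- The *empty representation* in dimension `n`: domain `∅`, integrand `0`; it represents `0`.
[Kontsevich–Zagier 2001, §1.2] [cite: KontsevichZagier2001, §1.2] -/
def empty (n : ℕ) : IntegralRep n where
  domain := ∅
  integrand := 0
  isSemialgebraic_domain := Literature.ModelTheory.ExponentialFields.isSemialgebraic_empty
  isSemialgebraicFunOn_integrand :=
    (isSemialgebraicFunOn_aeval Literature.ModelTheory.ExponentialFields.isSemialgebraic_empty 0).congr fun _ hx => hx.elim
  integrableOn := integrableOn_empty

/-- The domain of the empty representation. [KZ 2001, §1.2] [cite: KontsevichZagier2001, §1.2] -/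
@[simp] lemma domain_empty : (empty n).domain = ∅ := rfl

/-- The integrand of the empty representation. [KZ 2001, §1.2] [cite: KontsevichZagier2001, §1.2] -/
@[simp] lemma integrand_empty : (empty n).integrand = 0 := rfl

/-- The empty representation represents `0`. [KZ 2001, §1.2] [cite: KontsevichZagier2001, §1.2] -/
@[simp] theorem value_empty : (empty n).value = 0 := by
  simp [value]

/-- `[∅] ∈ relations`: domain additivity (rule (1)) for `∅ = ∅ ∪ ∅` reads `[∅] − [∅] − [∅] ∈
relations`, i.e. `−[∅] ∈ relations`. [KZ 2001, §1.2, rule (1)] [cite: KontsevichZagier2001, §1.2 rule (1)] -/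
theorem of_empty_mem_relations : of (empty n) ∈ relations := by
  have h : of (empty n) - of (empty n) - of (empty n) ∈ domainAddRel :=
    ⟨n, empty n, empty n, empty n, by simp, by simp, fun _ _ => rfl, fun _ _ => rfl, rfl⟩
  have := relations.neg_mem (domainAddRel_subset_relations h)
  simpa using this

/-! #### Slabs: raising the dimension by one Newton–Leibniz move -/

variable (r : IntegralRep n) (j : ℕ)

/-- The slab of height one at integer level `j` over the domain `σ` of `r`:
`{(x, t) | x ∈ σ, j ≤ t ≤ j + 1} ⊆ ℝⁿ⁺¹`, in the format of the Newton–Leibniz move.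
[KZ 2001, §1.2] [cite: KontsevichZagier2001, §1.2] -/
def slabDomain : Set (Fin (n + 1) → ℝ) :=
  {z | Fin.init z ∈ r.domain ∧ (j : ℝ) ≤ z (Fin.last n) ∧ z (Fin.last n) ≤ j + 1}

/-- Fibrewise membership in the slab. [KZ 2001, §1.2] [cite: KontsevichZagier2001, §1.2] -/
lemma snoc_mem_slabDomain {x : Fin n → ℝ} {t : ℝ} :
    Fin.snoc x t ∈ r.slabDomain j ↔ x ∈ r.domain ∧ t ∈ Icc (j : ℝ) (j + 1) := by
  simp [slabDomain]

/-- The slab is `ℚ`-semialgebraic (a cylinder cut by two polynomial inequalities).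
[KZ 2001, §1.2] [cite: KontsevichZagier2001, §1.2] -/
lemma isSemialgebraic_slabDomain : Literature.ModelTheory.ExponentialFields.IsSemialgebraic ℚ (r.slabDomain j) := by
  have h1 : Literature.ModelTheory.ExponentialFields.IsSemialgebraic ℚ {z : Fin (n + 1) → ℝ | (j : ℝ) ≤ z (Fin.last n)} := by
    simpa using Literature.ModelTheory.ExponentialFields.isSemialgebraic_setOf_eval_le (k := ℚ) (R := ℝ)
      (j : MvPolynomial (Fin (n + 1)) ℚ) (X (Fin.last n))
  have h2 : Literature.ModelTheory.ExponentialFields.IsSemialgebraic ℚ {z : Fin (n + 1) → ℝ | z (Fin.last n) ≤ j + 1} := by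
    simpa using Literature.ModelTheory.ExponentialFields.isSemialgebraic_setOf_eval_le (k := ℚ) (R := ℝ)
      (X (Fin.last n)) ((j : MvPolynomial (Fin (n + 1)) ℚ) + 1)
  convert (r.isSemialgebraic_domain.setOf_init_mem.inter h1).inter h2 using 1
  ext z
  simp only [slabDomain, mem_setOf_eq, mem_inter_iff, and_assoc]

/-- **Integrability on the slab**: `(x, t) ↦ f x` is absolutely integrable on `σ × [j, j + 1]`
(identify `ℝⁿ⁺¹` with `ℝ × ℝⁿ` by the volume-preserving `MeasurableEquiv.piFinSuccAbove`; the slab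
becomes `[j, j + 1] ×ˢ σ`, of finite measure in the first factor, and `Integrable.comp_snd`
applies). [KZ 2001, §1.2] [cite: KontsevichZagier2001, §1.2] -/
lemma integrableOn_slabDomain :
    IntegrableOn (fun z : Fin (n + 1) → ℝ => r.integrand (Fin.init z)) (r.slabDomain j) := by
  set e : (Fin (n + 1) → ℝ) ≃ᵐ ℝ × (Fin n → ℝ) :=
    MeasurableEquiv.piFinSuccAbove (fun _ => ℝ) (Fin.last n) with he_def
  have he : MeasurePreserving e volume volume :=
    volume_preserving_piFinSuccAbove (fun _ => ℝ) (Fin.last n)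
  have he_symm : ∀ p : ℝ × (Fin n → ℝ), e.symm p = Fin.snoc p.2 p.1 := fun p => by
    simp [he_def, MeasurableEquiv.piFinSuccAbove, Fin.snocEquiv]
  rw [← (he.symm e).integrableOn_comp_preimage e.symm.measurableEmbedding]
  have hpre : e.symm ⁻¹' r.slabDomain j = Icc (j : ℝ) (j + 1) ×ˢ r.domain := by
    ext p
    rw [mem_preimage, he_symm, snoc_mem_slabDomain, mem_prod, and_comm]
  have hcomp : ((fun z : Fin (n + 1) → ℝ => r.integrand (Fin.init z)) ∘ e.symm) =
      fun p => r.integrand p.2 := by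
    ext p
    simp [he_symm]
  rw [hpre, hcomp, IntegrableOn, Measure.volume_eq_prod, ← Measure.prod_restrict]
  exact r.integrableOn.comp_snd _

/-- **The slab representation** over `r = (σ, f)` at level `j`: dimension `n + 1`, domain
`σ × [j, j + 1]`, integrand `(x, t) ↦ f x`; it represents the same number (Fubini), and indeed
differs from `r` by a single Newton–Leibniz move (`of_slab_sub_of_mem_newtonLeibnizRel`).
[KZ 2001, §1.2] [cite: KontsevichZagier2001, §1.2] -/
def slab : IntegralRep (n + 1) where
  domain := r.slabDomain j
  integrand z := r.integrand (Fin.init z)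
  isSemialgebraic_domain := r.isSemialgebraic_slabDomain j
  isSemialgebraicFunOn_integrand :=
    r.isSemialgebraicFunOn_integrand.comp_init.mono (fun _ hz => hz.1)
      (r.isSemialgebraic_slabDomain j)
  integrableOn := r.integrableOn_slabDomain j

/-- The domain of the slab representation. [KZ 2001, §1.2] [cite: KontsevichZagier2001, §1.2] -/
@[simp] lemma domain_slab : (r.slab j).domain = r.slabDomain j := rfl

/-- The integrand of the slab representation. [KZ 2001, §1.2] [cite: KontsevichZagier2001, §1.2] -/
@[simp] lemma integrand_slab : (r.slab j).integrand = fun z => r.integrand (Fin.init z) := rfl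

/-- `[slab r j] − [r]` is a single Newton–Leibniz move (printed rule (3)) with base `r`, constant
edges `a = j ≤ b = j + 1` and primitive `F (x, t) = t · f x`: `∂F/∂t = f x` is the slab integrand
and `F (x, j + 1) − F (x, j) = f x`. [KZ 2001, §1.2, rule (3)] [cite: KontsevichZagier2001, §1.2 rule (3)] -/
theorem of_slab_sub_of_mem_newtonLeibnizRel : of (r.slab j) - of r ∈ newtonLeibnizRel := by
  refine ⟨n, r.slab j, r, fun _ => (j : ℝ), fun _ => (j : ℝ) + 1,
    fun z => z (Fin.last n) * r.integrand (Fin.init z), ?_,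
    isSemialgebraicFunOn_natCast r.isSemialgebraic_domain j, ?_, fun _ _ => by linarith, rfl,
    ?_, ?_, ?_, rfl⟩
  · -- `F = X_last · (f ∘ init)` is a product of semialgebraic functions on the slab
    exact IsSemialgebraicFunOn.mul_holds
      ((isSemialgebraicFunOn_aeval (r.isSemialgebraic_slabDomain j) (X (Fin.last n))).congr
        fun z _ => by simp)
      (r.slab j).isSemialgebraicFunOn_integrand
  · -- `b = j + 1` is semialgebraic
    exact (isSemialgebraicFunOn_aeval r.isSemialgebraic_domain
      ((j : MvPolynomial (Fin n) ℚ) + 1)).congr fun x _ => by simp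
  · -- continuity of `t ↦ t · f x` on the closed fibre
    intro x _
    simp only [Fin.snoc_last, Fin.init_snoc]
    fun_prop
  · -- `d/dt (t · f x) = f x` on the open fibre
    intro x _ t _
    simp only [integrand_slab, Fin.snoc_last, Fin.init_snoc]
    exact hasDerivAt_mul_const _
  · -- the boundary term is the original integrand
    intro x _
    simp only [Fin.snoc_last, Fin.init_snoc]
    ring

/-- `r` is equivalent to its slab representations. [KZ 2001, §1.2] [cite: KontsevichZagier2001, §1.2] -/
theorem equivalent_slab : Equivalent r (r.slab j) :=
  Equivalent.symm (newtonLeibnizRel_subset_relations (r.of_slab_sub_of_mem_newtonLeibnizRel j))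

/-- **Raising the dimension.** Every representation is equivalent to one in each higher dimension
`n + d` (iterate the slab construction). [KZ 2001, §1.2] [cite: KontsevichZagier2001, §1.2] -/
theorem exists_equivalent_add : ∀ d : ℕ, ∃ R : IntegralRep (n + d), Equivalent r R
  | 0 => ⟨r, Equivalent.refl r⟩
  | d + 1 => by
    obtain ⟨R, hR⟩ := exists_equivalent_add d
    exact ⟨R.slab 0, hR.trans (R.equivalent_slab 0)⟩

/-- Every representation is equivalent to one in any dimension `N ≥ n`. [KZ 2001, §1.2] [cite: KontsevichZagier2001, §1.2] -/
theorem exists_equivalent_of_le {N : ℕ} (h : n ≤ N) : ∃ R : IntegralRep N, Equivalent r R := by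
  obtain ⟨d, rfl⟩ := Nat.exists_eq_add_of_le h
  exact r.exists_equivalent_add d

/-! #### Gluing representations with disjoint domains -/

variable {r}

/-- **Gluing.** Two representations of the same dimension with disjoint domains `σ₁`, `σ₂` glue to
the representation with domain `σ₁ ∪ σ₂` and integrand `𝟙_{σ₁} f₁ + 𝟙_{σ₂} f₂` (which is `fᵢ` on
`σᵢ`). [KZ 2001, §1.2, rule (1)] [cite: KontsevichZagier2001, §1.2 rule (1)] -/
def glue (r₁ r₂ : IntegralRep n) (h : Disjoint r₁.domain r₂.domain) : IntegralRep n where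
  domain := r₁.domain ∪ r₂.domain
  integrand z := r₁.domain.indicator r₁.integrand z + r₂.domain.indicator r₂.integrand z
  isSemialgebraic_domain := r₁.isSemialgebraic_domain.union r₂.isSemialgebraic_domain
  isSemialgebraicFunOn_integrand :=
    r₁.isSemialgebraicFunOn_integrand.union r₂.isSemialgebraicFunOn_integrand
      (fun z hz => by
        simp [indicator_of_mem hz, indicator_of_notMem (Set.disjoint_left.mp h hz)])
      (fun z hz => by
        simp [indicator_of_mem hz, indicator_of_notMem (Set.disjoint_right.mp h hz)])
  integrableOn :=
    (r₁.integrableOn.congr_fun (fun z hz => by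
        simp [indicator_of_mem hz, indicator_of_notMem (Set.disjoint_left.mp h hz)])
      (measurableSet_domain_holds r₁)).union
    (r₂.integrableOn.congr_fun (fun z hz => by
        simp [indicator_of_mem hz, indicator_of_notMem (Set.disjoint_right.mp h hz)])
      (measurableSet_domain_holds r₂))

/-- The domain of the glued representation. [KZ 2001, §1.2] [cite: KontsevichZagier2001, §1.2] -/
@[simp] lemma domain_glue (r₁ r₂ : IntegralRep n) (h : Disjoint r₁.domain r₂.domain) :
    (r₁.glue r₂ h).domain = r₁.domain ∪ r₂.domain := rfl

/-- The glued integrand is `f₁` on `σ₁`. [KZ 2001, §1.2] [cite: KontsevichZagier2001, §1.2] -/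
lemma eqOn_integrand_glue_left (r₁ r₂ : IntegralRep n) (h : Disjoint r₁.domain r₂.domain) :
    EqOn (r₁.glue r₂ h).integrand r₁.integrand r₁.domain := fun z hz => by
  simp [glue, indicator_of_mem hz, indicator_of_notMem (Set.disjoint_left.mp h hz)]

/-- The glued integrand is `f₂` on `σ₂`. [KZ 2001, §1.2] [cite: KontsevichZagier2001, §1.2] -/
lemma eqOn_integrand_glue_right (r₁ r₂ : IntegralRep n) (h : Disjoint r₁.domain r₂.domain) :
    EqOn (r₁.glue r₂ h).integrand r₂.integrand r₂.domain := fun z hz => by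
  simp [glue, indicator_of_mem hz, indicator_of_notMem (Set.disjoint_right.mp h hz)]

/-- `[glue r₁ r₂] − [r₁] − [r₂]` is a single domain-additivity move (rule (1)).
[KZ 2001, §1.2, rule (1)] [cite: KontsevichZagier2001, §1.2 rule (1)] -/
theorem of_glue_sub_sub_mem_domainAddRel (r₁ r₂ : IntegralRep n)
    (h : Disjoint r₁.domain r₂.domain) :
    of (r₁.glue r₂ h) - of r₁ - of r₂ ∈ domainAddRel :=
  ⟨n, r₁.glue r₂ h, r₁, r₂, rfl, by simp [h.inter_eq], eqOn_integrand_glue_left r₁ r₂ h,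
    eqOn_integrand_glue_right r₁ r₂ h, rfl⟩

/-- The slabs at levels `0` and `2` over two representations of the same dimension are disjoint.
[KZ 2001, §1.2] [cite: KontsevichZagier2001, §1.2] -/
lemma disjoint_domain_slab_zero_two (r₁ r₂ : IntegralRep n) :
    Disjoint (r₁.slab 0).domain (r₂.slab 2).domain := by
  rw [Set.disjoint_left]
  rintro z ⟨-, -, h₁⟩ ⟨-, h₂, -⟩
  simp only [Nat.cast_zero, Nat.cast_ofNat] at h₁ h₂
  linarith

/-- **Merging two representations into one.** For representations `r₁`, `r₂` of arbitrary
dimensions there is a single representation `R` with `[r₁] + [r₂] − [R] ∈ relations`: raise both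
to the common dimension `max n m` by slabs, put them at the disjoint levels `[0, 1]` and `[2, 3]` of
one more coordinate, and glue by domain additivity.
[KZ 2001, §1.2, rules (1), (3)] [cite: KontsevichZagier2001, §1.2] -/
theorem exists_of_add_of_sub_of_mem_relations (r₁ : IntegralRep n) (r₂ : IntegralRep m) :
    ∃ (N : ℕ) (R : IntegralRep N), of r₁ + of r₂ - of R ∈ relations := by
  obtain ⟨R₁, h₁⟩ := r₁.exists_equivalent_of_le (le_max_left n m)
  obtain ⟨R₂, h₂⟩ := r₂.exists_equivalent_of_le (le_max_right n m)
  have hS₁ : Equivalent r₁ (R₁.slab 0) := h₁.trans (R₁.equivalent_slab 0)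
  have hS₂ : Equivalent r₂ (R₂.slab 2) := h₂.trans (R₂.equivalent_slab 2)
  have hd := disjoint_domain_slab_zero_two R₁ R₂
  refine ⟨max n m + 1, (R₁.slab 0).glue (R₂.slab 2) hd, ?_⟩
  have hglue := domainAddRel_subset_relations (of_glue_sub_sub_mem_domainAddRel _ _ hd)
  have : of r₁ + of r₂ - of ((R₁.slab 0).glue (R₂.slab 2) hd) =
      (of r₁ - of (R₁.slab 0)) + (of r₂ - of (R₂.slab 2)) -
        (of ((R₁.slab 0).glue (R₂.slab 2) hd) - of (R₁.slab 0) - of (R₂.slab 2)) := by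
    abel
  rw [this]
  exact relations.sub_mem (relations.add_mem hS₁ hS₂) hglue

end IntegralRep

/-- **Discharge of the named fact `Literature.NumberTheory.Transcendental.KZ.exists_integralRep_sub`**: every formal `ℤ`-combination
of integral representations is, modulo the moves, a difference `[r] − [r']` of two
representations. Induction on the free abelian group: `0 ≡ [∅] − [∅]`; a generator `[r] ≡ [r] − [∅]`
and `−[r] ≡ [∅] − [r]` since `[∅] ∈ relations` (`IntegralRep.of_empty_mem_relations`); and sums are
merged by `IntegralRep.exists_of_add_of_sub_of_mem_relations` (slabs in a common dimension at
disjoint levels, glued by domain additivity). Kontsevich–Zagier state the rules for passing between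
two representations; this lemma is the bookkeeping that identifies that formulation with the
kernel formulation on the formal group. [KZ 2001, §1.2] [cite: KontsevichZagier2001, §1.2] -/
theorem exists_integralRep_sub_holds : exists_integralRep_sub := by
  intro c
  induction c using FreeAbelianGroup.induction_on with
  | zero => exact ⟨0, 0, IntegralRep.empty 0, IntegralRep.empty 0, by simp⟩
  | of x =>
    obtain ⟨n, r⟩ := x
    refine ⟨n, 0, r, IntegralRep.empty 0, ?_⟩
    have : FreeAbelianGroup.of (⟨n, r⟩ : Σ k, IntegralRep k) - (of r - of (IntegralRep.empty 0)) =
        of (IntegralRep.empty 0) := by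
      simp [of]
    rw [this]
    exact IntegralRep.of_empty_mem_relations
  | neg x _ =>
    obtain ⟨n, r⟩ := x
    refine ⟨0, n, IntegralRep.empty 0, r, ?_⟩
    have : -FreeAbelianGroup.of (⟨n, r⟩ : Σ k, IntegralRep k) - (of (IntegralRep.empty 0) - of r) =
        -of (IntegralRep.empty 0) := by
      simp only [of]
      abel
    rw [this]
    exact relations.neg_mem IntegralRep.of_empty_mem_relations
  | add x y hx hy =>
    obtain ⟨n₁, m₁, r₁, r₁', h₁⟩ := hx
    obtain ⟨n₂, m₂, r₂, r₂', h₂⟩ := hy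
    obtain ⟨N, R, hR⟩ := r₁.exists_of_add_of_sub_of_mem_relations r₂
    obtain ⟨N', R', hR'⟩ := r₁'.exists_of_add_of_sub_of_mem_relations r₂'
    refine ⟨N, N', R, R', ?_⟩
    have : x + y - (of R - of R') = (x - (of r₁ - of r₁')) + (y - (of r₂ - of r₂')) +
        (of r₁ + of r₂ - of R) - (of r₁' + of r₂' - of R') := by
      abel
    rw [this]
    exact relations.sub_mem (relations.add_mem (relations.add_mem h₁ h₂) hR) hR'

end KZ

end Literature.NumberTheory.Transcendental
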